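import Mathlib
import Summits.NavierStokesRegularity.NavierStokesRegularity.Theorems.ThreadingFluxAzimuthalCartanDefs
import Summits.NavierStokesRegularity.NavierStokesRegularity.Theorems.ThreadingFluxAzimuthalCartanVertexWitnessDefs
import Summits.NavierStokesRegularity.NavierStokesRegularity.Theorems.ThreadingFluxAzimuthalCartanVertexWitnessMirrorTilt
import Summits.NavierStokesRegularity.NavierStokesRegularity.Theorems.ThreadingFluxAzimuthalCartanVertexWitnessLaplacian
import Summits.NavierStokesRegularity.NavierStokesRegularity.Theorems.ThreadingFluxAzimuthalCartanVertexWitnessNonEquivariant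
import Summits.NavierStokesRegularity.NavierStokesRegularity.Theorems.ThreadingFluxAzimuthalCartanVertexWitnessMomentumB
import HarnessLib

/-!
# Crux `PoloidalLiouville` (stmt-NavierStokesRegularity-1222, W1), crux idea «azimuthal-cartan-test» (ns-idea-15 g10, V26):
# ★★★ V♯ `LandauVertexFlexibility` HOLDS — the Landau vertex is infinitesimally flexible at azimuthal mode 2

`LandauVertexFlexibility` (Defs twin `ThreadingFluxAzimuthalCartanDefs`, sketch `Cruxes/PoloidalLiouville/AzimuthalCartanSketch.lean`
v1.3b l.330): there are `δv, δp`, real-analytic on `landauTorus`, solving steady Navier–Stokes linearised at Landau's flow `landau2`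
(`c = 2`, axis `e₂`) there, unthreaded about the vertex, and NOT of the form «tilt of the base + `J₃`-equivariant field».
The explicit witness is `(δvf, δpf)` of `…VertexWitnessDefs` — the ε-derivative of Šverák's conformal family at the Landau flow, an
azimuthal MODE-2 field `δv = ∇θ + g·id` (crux note `AzimuthalCartanVertexWitness.md`).  Clauses: analytic `δv`, `δp`, unthreaded,
not tilt+equivariant, and the reduction `landauVertexFlexibility_of_linearisedSteadyNSOn` — `…VertexWitnessNonEquivariant.lean`;
`div δv = 0` — `…VertexWitnessLaplacian.lean`; the linearised momentum identity — `…VertexWitnessMomentumB.lean`.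

CONSEQUENCE FOR THE LINE (information, no claim about ⟨1222⟩): V26's Cartan count at the LANDAU base with the VERTEX as centre is NOT
rigid at mode 2 — the vertex-degenerate case of the azimuthal-cartan test needs the extra normalisation the sketch anticipated (critic V26
P3); `PoloidalLiouville` (1222), W1 and NS regularity stay OPEN / NOT proved.  `--supports stmt-NavierStokesRegularity-1222 --as helper`;
0 kit.  [folklore]
-/

-- the summit and its single problem share the name (D-0017 nested layout)
set_option linter.dupNamespace false

noncomputable section

open scoped RealInnerProductSpace
open Literature.Analysis.FluidPDE

namespace Summit.NavierStokesRegularity.NavierStokesRegularity.Theorems.PoloidalLiouville.AzimuthalCartan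

open Summit.NavierStokesRegularity.NavierStokesRegularity.Theorems.PoloidalLiouville.CentreJet (E3)

namespace VertexWitness

/-- **The `LinearisedSteadyNSOn` clause of V♯ for the explicit witness, BY NAME** (`div`: `divergence_witness`; momentum:
`momentum_witness`; torus points are off the axis ray: `norm_ne_apply_two_of_mem_landauTorus`). [folklore] -/
theorem linearisedSteadyNSOn_witness : LinearisedSteadyNSOn landauTorus landau2 δvf δpf :=
  ⟨fun _ hx => divergence_witness (norm_ne_apply_two_of_mem_landauTorus hx),
    fun _ hx => momentum_witness (norm_ne_apply_two_of_mem_landauTorus hx)⟩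

end VertexWitness

/-- ★★★ **V♯ `LandauVertexFlexibility` holds** (the explicit mode-2 witness `(δvf, δpf)`; all five conjuncts are tree theorems:
`VertexWitness.landauVertexFlexibility_of_linearisedSteadyNSOn` + `VertexWitness.linearisedSteadyNSOn_witness`).  This settles the
sketch's V♯ in the AFFIRMATIVE (flexibility); it does NOT prove `PoloidalLiouville` (1222), W1 or NS regularity. [folklore] -/
theorem landauVertexFlexibility_holds : LandauVertexFlexibility :=
  VertexWitness.landauVertexFlexibility_of_linearisedSteadyNSOn VertexWitness.linearisedSteadyNSOn_witness

end Summit.NavierStokesRegularity.NavierStokesRegularity.Theorems.PoloidalLiouville.AzimuthalCartan
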